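import Summits.RiemannHypothesis.RiemannHypothesis.Theorems.LeeYangLeeyangThesisStubTaylorSuper
import Summits.RiemannHypothesis.RiemannHypothesis.Theorems.LeeYangLeeyangThesisStubCalDensity
import Summits.RiemannHypothesis.RiemannHypothesis.Theorems.LeeYangLeeyangThesisStubCalBulk
import Summits.RiemannHypothesis.RiemannHypothesis.Theorems.LeeYangLeeyangThesisStubCalEnd
import Literature.Analysis.InverseSpectral.KreinString
import Literature.Analysis.InverseSpectral.KreinStringProofs
import Literature.Analysis.InverseSpectral.KreinStringPositivity
import HarnessLib

/-!
# RiemannHypothesis / LeeYang — crux `LeeyangThesis`, line `Sketch`: the calibration bound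

The real transfer function of the calibration string (density `ρ(y) = 1/((L-y)² log²(A/(L-y)))` on
`[0, L)`, `A ≥ e·L`) is bounded explicitly:
`Re φ(y, -r²) ≤ (u₀/u_L)^r (1 + 2r)` for `y ∈ [0, L)`, `r > 0`, with `u_L = log(A/L)` and
`u₀ = max u_L (2 + r + 2r²)` (`stub_calBound`), i.e. `log sup_y φ(y, -r²) = O(r log r)` — ξ-type
growth. Proof: the comparison principle `phi_neg_re_le_of_supersolution` (supersolutions of the
integral equation dominate the Picard partial sums) applied to the glued `C¹` majorant built from
`stub_calBulk` (bulk piece `(u/u_L)^r`) and `stub_calEnd` (end piece `K - u^{-1/2}`, scaled), whose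
integral supersolution inequality comes from `stub_taylorSuper`.
-/

noncomputable section

-- single-problem summit namespace `Summit.RiemannHypothesis.RiemannHypothesis.…` (D-0017)
set_option linter.dupNamespace false

open MeasureTheory Filter Topology Complex Set
open scoped ENNReal
open Literature.Analysis.InverseSpectral

namespace Summit.RiemannHypothesis.RiemannHypothesis.Theorems.LeeYangTelegraphString

/-! ### Comparison on the negative axis -/

/-- Partial sums of the Picard series satisfy the Volterra recursion
`Σ_{m ≤ n+1} sᵐ φₘ(y) = 1 + s ∫_{[0,y]} (y - t) (Σ_{m ≤ n} sᵐ φₘ(t)) dm(t)`. [folklore] -/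
theorem picard_partialSum_succ (S : KreinString) (s : ℝ) (n : ℕ) {x : ℝ} (hx : x ∈ S.dom)
    {y : ℝ} (hy : y ∈ Icc 0 x) :
    ∑ m ∈ Finset.range (n + 2), s ^ m * S.picard (fun _ => (1 : ℝ)) m y =
      1 + s * ∫ t in Icc 0 y, (y - t) * (∑ m ∈ Finset.range (n + 1),
        s ^ m * S.picard (fun _ => (1 : ℝ)) m t) ∂S.massMeasure := by
  have hyd : y ∈ S.dom := S.Icc_subset_dom hx hy
  rw [Finset.sum_range_succ', pow_zero, one_mul, S.picard_zero, add_comm]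
  congr 1
  have hint : ∀ m ∈ Finset.range (n + 1), IntegrableOn
      (fun t => (y - t) * (s ^ m * S.picard (fun _ => (1 : ℝ)) m t)) (Icc 0 y) S.massMeasure := by
    intro m _
    refine S.integrableOn_Icc_of_continuousOn hyd ?_
    exact (continuousOn_const.sub continuousOn_id).mul
      (continuousOn_const.mul (S.continuousOn_picard hyd continuousOn_const m))
  calc ∑ m ∈ Finset.range (n + 1), s ^ (m + 1) * S.picard (fun _ => (1 : ℝ)) (m + 1) y
      = ∑ m ∈ Finset.range (n + 1), s * ∫ t in Icc 0 y,
          (y - t) * (s ^ m * S.picard (fun _ => (1 : ℝ)) m t) ∂S.massMeasure := by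
        refine Finset.sum_congr rfl fun m _ => ?_
        rw [S.picard_succ, pow_succ, ← integral_const_mul, ← integral_const_mul]
        refine integral_congr_ae (Eventually.of_forall fun t => ?_)
        simp only
        ring
    _ = s * ∫ t in Icc 0 y, (y - t) * (∑ m ∈ Finset.range (n + 1),
          s ^ m * S.picard (fun _ => (1 : ℝ)) m t) ∂S.massMeasure := by
        rw [← Finset.mul_sum, ← integral_finsetSum _ hint]
        congr 1
        refine integral_congr_ae (Eventually.of_forall fun t => ?_)
        simp only [Finset.mul_sum]

/-- **Comparison: integral supersolutions dominate the Picard partial sums.** [folklore] -/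
theorem picard_partialSum_le_of_supersolution (S : KreinString) {s : ℝ} (hs : 0 ≤ s) {x : ℝ}
    (hx : x ∈ S.dom) {g : ℝ → ℝ} (hg : ContinuousOn g (Icc 0 x)) (hg0 : ∀ y ∈ Icc 0 x, 0 ≤ g y)
    (hsuper : ∀ y ∈ Icc 0 x, 1 + s * ∫ t in Icc 0 y, (y - t) * g t ∂S.massMeasure ≤ g y)
    (n : ℕ) : ∀ y ∈ Icc 0 x, ∑ m ∈ Finset.range (n + 1), s ^ m * S.picard (fun _ => (1 : ℝ)) m y ≤ g y := by
  induction n with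
  | zero =>
    intro y hy
    simp only [zero_add, Finset.range_one, Finset.sum_singleton, pow_zero, S.picard_zero, one_mul]
    refine le_trans ?_ (hsuper y hy)
    have : 0 ≤ ∫ t in Icc 0 y, (y - t) * g t ∂S.massMeasure :=
      setIntegral_nonneg measurableSet_Icc fun t ht =>
        mul_nonneg (sub_nonneg.2 ht.2) (hg0 t ⟨ht.1, ht.2.trans hy.2⟩)
    nlinarith
  | succ n ih =>
    intro y hy
    have hyd : y ∈ S.dom := S.Icc_subset_dom hx hy
    rw [picard_partialSum_succ S s n hx hy]
    refine le_trans ?_ (hsuper y hy)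
    refine add_le_add le_rfl (mul_le_mul_of_nonneg_left ?_ hs)
    refine setIntegral_mono_on ?_ ?_ measurableSet_Icc fun t ht => ?_
    · refine S.integrableOn_Icc_of_continuousOn hyd ?_
      refine (continuousOn_const.sub continuousOn_id).mul ?_
      refine continuousOn_finsetSum _ fun m _ => ?_
      exact continuousOn_const.mul (S.continuousOn_picard hyd continuousOn_const m)
    · exact S.integrableOn_Icc_of_continuousOn hyd
        ((continuousOn_const.sub continuousOn_id).mul (hg.mono (Icc_subset_Icc_right hy.2)))
    · exact mul_le_mul_of_nonneg_left (ih t ⟨ht.1, ht.2.trans hy.2⟩) (sub_nonneg.2 ht.2)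

/-- **Comparison principle on the negative axis.** If `g ≥ 0` is continuous on `[0, x]` and
`1 + s ∫_{[0,y]} (y - t) g(t) dm(t) ≤ g(y)` on `[0, x]` (`s ≥ 0`), then `Re φ(y, -s) ≤ g(y)` on
`[0, x]`. [folklore] -/
theorem phi_neg_re_le_of_supersolution (S : KreinString) {s : ℝ} (hs : 0 ≤ s) {x : ℝ}
    (hx : x ∈ S.dom) {g : ℝ → ℝ} (hg : ContinuousOn g (Icc 0 x)) (hg0 : ∀ y ∈ Icc 0 x, 0 ≤ g y)
    (hsuper : ∀ y ∈ Icc 0 x, 1 + s * ∫ t in Icc 0 y, (y - t) * g t ∂S.massMeasure ≤ g y)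
    {y : ℝ} (hy : y ∈ Icc 0 x) : (S.phi (-(s : ℂ)) y).re ≤ g y := by
  rw [S.phi_neg_re]
  refine Real.tsum_le_of_sum_range_le (fun m => mul_nonneg (pow_nonneg hs m)
    (S.picard_nonneg (fun _ _ => zero_le_one) m hy.1)) fun n => ?_
  cases n with
  | zero => simpa using (hg0 y hy)
  | succ n => exact picard_partialSum_le_of_supersolution S hs hx hg hg0 hsuper n y hy

/-! ### The calibration bound -/

/-- **Stub calBound — the real transfer function of the calibration string is `e^{O(r log r)}`.**
For the Kreĭn string of length `L` with density `1/((L-y)² log²(A/(L-y)))` on `[0, L)` (`A ≥ eL`)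
and `r > 0`: `Re φ(y, -r²) ≤ (u₀/u_L)^r (1 + 2r)` on `[0, L)`, `u_L = log(A/L)`,
`u₀ = max u_L (2 + r + 2r²)`. [folklore] -/
theorem stub_calBound : ∀ (L A r : ℝ), 0 < L → Real.exp 1 * L ≤ A → 0 < r →
    ∀ S : KreinString, S.length = ENNReal.ofReal L →
    S.massMeasure = (volume.withDensity fun y => ENNReal.ofReal
      ((fun y : ℝ => if 0 ≤ y ∧ y < L then 1 / ((L - y) ^ 2 * Real.log (A / (L - y)) ^ 2) else 0) y)).restrict
      (Set.Iio L) →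
    ∀ y ∈ Set.Ico 0 L, (S.phi (-((r ^ 2 : ℝ) : ℂ)) y).re ≤
      (max (Real.log (A / L)) (2 + r + 2 * r ^ 2) / Real.log (A / L)) ^ r * (1 + 2 * r) := by
  intro L A r hL hA hr S hlen hmass y hy
  -- the density and its string-side facts
  set ρ : ℝ → ℝ := fun y : ℝ => if 0 ≤ y ∧ y < L then
    1 / ((L - y) ^ 2 * Real.log (A / (L - y)) ^ 2) else 0 with hρ
  have hρmeas : Measurable ρ := (stub_calDensity L A hL hA).1
  have hρcont : ContinuousOn ρ (Ico 0 L) := (stub_calDensity L A hL hA).2.2.1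
  have hρpos : ∀ t ∈ Ico 0 L, 0 < ρ t := (stub_calDensity L A hL hA).2.2.2.1
  have hρeq : ∀ t ∈ Ico 0 L, ρ t = 1 / ((L - t) ^ 2 * Real.log (A / (L - t)) ^ 2) := by
    intro t ht
    simp only [hρ, if_pos (show 0 ≤ t ∧ t < L from ⟨ht.1, ht.2⟩)]
  have hρnn : ∀ t, 0 ≤ ρ t := by
    intro t
    by_cases ht : 0 ≤ t ∧ t < L
    · exact (hρpos t ⟨ht.1, ht.2⟩).le
    · simp only [hρ, if_neg ht]; exact le_rfl
  -- parameters
  have hA0 : 0 < A := lt_of_lt_of_le (by positivity) hA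
  have huL : 1 ≤ Real.log (A / L) := by
    rw [Real.le_log_iff_exp_le (by positivity), le_div_iff₀ hL]
    exact hA
  have huL0 : 0 < Real.log (A / L) := by linarith
  have hu0L : Real.log (A / L) ≤ max (Real.log (A / L)) (2 + r + 2 * r ^ 2) := le_max_left _ _
  have hu0r : 2 + r + 2 * r ^ 2 ≤ max (Real.log (A / L)) (2 + r + 2 * r ^ 2) := le_max_right _ _
  -- the two pieces (before introducing abbreviations, so that `set` folds them)
  obtain ⟨hder1, hcont1', hg10, h1le, hmono1, hineq1⟩ := stub_calBulk L A r hL hA hr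
  obtain ⟨hy10, hy1L, huy1, hder2, hcont2', hbnd2, hslope, hineq2⟩ :=
    stub_calEnd L A r (max (Real.log (A / L)) (2 + r + 2 * r ^ 2)) hL hA hr hu0L hu0r
  set u0 := max (Real.log (A / L)) (2 + r + 2 * r ^ 2) with hu0def
  have hu00 : 0 < u0 := by linarith
  set t1 := A * Real.exp (-u0) with ht1def
  have ht10 : 0 < t1 := by positivity
  set y1 := L - t1 with hy1def
  have hLy1 : L - y1 = t1 := by simp [hy1def]
  have huy1' : Real.log (A / (L - y1)) = u0 := by simpa only [hLy1, sub_sub_cancel] using huy1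
  have huy1t : Real.log (A / t1) = u0 := by rw [← hLy1]; exact huy1'
  set K := u0 ^ (-(1 / 2 : ℝ)) * (1 + 1 / (2 * r)) with hKdef
  set D := u0 ^ (-(1 / 2 : ℝ)) * (1 / (2 * r)) with hDdef
  have hD0 : 0 < D := by positivity
  have hKD : K - u0 ^ (-(1 / 2 : ℝ)) = D := by simp only [hKdef, hDdef]; ring
  have hKoverD : K / D = 1 + 2 * r := by
    simp only [hKdef, hDdef]
    have hu : u0 ^ (-(1 / 2 : ℝ)) ≠ 0 := (Real.rpow_pos_of_pos hu00 _).ne'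
    field_simp
    ring
  set c := (u0 / Real.log (A / L)) ^ r with hcdef
  have hc0 : 0 < c := Real.rpow_pos_of_pos (div_pos hu00 huL0) _
  set g1 : ℝ → ℝ := fun y => (Real.log (A / (L - y)) / Real.log (A / L)) ^ r with hg1def
  set g1' : ℝ → ℝ := fun y => r * (Real.log (A / (L - y)) / Real.log (A / L)) ^ r /
    ((L - y) * Real.log (A / (L - y))) with hg1'def
  set g2 : ℝ → ℝ := fun y => K - Real.log (A / (L - y)) ^ (-(1 / 2 : ℝ)) with hg2def
  set g2' : ℝ → ℝ := fun y => (1 / 2) * Real.log (A / (L - y)) ^ (-(3 / 2 : ℝ)) / (L - y)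
    with hg2'def
  -- values at the junction
  have hg1y1 : g1 y1 = c := by simp only [hg1def, hcdef]; rw [huy1']
  have hg2y1 : g2 y1 = D := by simp only [hg2def]; rw [huy1', hKD]
  have hg1'y1 : g1' y1 = r * c / (t1 * u0) := by
    simp only [hg1'def, hcdef]; rw [huy1', hLy1]
  have hg2'y1 : g2' y1 = r / (t1 * u0) * D := by
    simp only [hg2'def]; rw [huy1', hLy1]; exact hslope
  -- the glued majorant
  set g : ℝ → ℝ := fun y => if y ≤ y1 then g1 y else c * g2 y / D with hgdef
  set g' : ℝ → ℝ := fun y => if y ≤ y1 then g1' y else c * g2' y / D with hg'def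
  have hjunc : g1 y1 = c * g2 y1 / D := by rw [hg1y1, hg2y1]; field_simp
  have hjunc' : g1' y1 = c * g2' y1 / D := by rw [hg1'y1, hg2'y1]; field_simp
  have hg_le : ∀ a, a ≤ y1 → g a = g1 a := fun a ha => by simp only [hgdef, if_pos ha]
  have hg_gt : ∀ a, y1 < a → g a = c * g2 a / D := fun a ha => by
    simp only [hgdef, if_neg (not_le.2 ha)]
  have hg_ge : ∀ a, y1 ≤ a → g a = c * g2 a / D := fun a ha => by
    rcases eq_or_lt_of_le ha with h | h
    · rw [← h, hg_le y1 le_rfl]; exact hjunc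
    · exact hg_gt a h
  have hg'_le : ∀ a, a ≤ y1 → g' a = g1' a := fun a ha => by simp only [hg'def, if_pos ha]
  have hg'_gt : ∀ a, y1 < a → g' a = c * g2' a / D := fun a ha => by
    simp only [hg'def, if_neg (not_le.2 ha)]
  -- continuity of the pieces
  have hcont1 : ContinuousOn g1 (Ico 0 L) := fun t ht => (hder1 t ht).continuousAt.continuousWithinAt
  have hcont2 : ContinuousOn g2 (Ico y1 L) := fun t ht => (hder2 t ht).continuousAt.continuousWithinAt
  have hfront : frontier {a : ℝ | a ≤ y1} = {y1} := by
    rw [show {a : ℝ | a ≤ y1} = Iic y1 from rfl, frontier_Iic]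
  have hclos2 : closure {a : ℝ | ¬a ≤ y1} = Ici y1 := by
    rw [show {a : ℝ | ¬a ≤ y1} = Ioi y1 by ext a; simp, closure_Ioi]
  have hgc : ContinuousOn g (Ico 0 L) := by
    refine ContinuousOn.if ?_ ?_ ?_
    · rintro a ⟨-, ha⟩
      rw [hfront, mem_singleton_iff] at ha
      rw [ha]; exact hjunc
    · exact hcont1.mono inter_subset_left
    · rw [hclos2]
      refine ContinuousOn.div_const (ContinuousOn.mul continuousOn_const (hcont2.mono ?_)) _
      rintro a ⟨⟨-, haL⟩, ha⟩; exact ⟨ha, haL⟩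
  have hg'c : ContinuousOn g' (Ico 0 L) := by
    refine ContinuousOn.if ?_ ?_ ?_
    · rintro a ⟨-, ha⟩
      rw [hfront, mem_singleton_iff] at ha
      rw [ha]; exact hjunc'
    · exact hcont1'.mono inter_subset_left
    · rw [hclos2]
      refine ContinuousOn.div_const (ContinuousOn.mul continuousOn_const (hcont2'.mono ?_)) _
      rintro a ⟨⟨-, haL⟩, ha⟩; exact ⟨ha, haL⟩
  -- derivative of the glued majorant
  have hder : ∀ t ∈ Ioo 0 L, HasDerivAt g (g' t) t := by
    intro t ht
    rcases lt_trichotomy t y1 with hlt | heq | hgt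
    · have hev : g =ᶠ[𝓝 t] g1 := by
        filter_upwards [Iio_mem_nhds hlt] with a ha
        exact hg_le a (le_of_lt ha)
      rw [hg'_le t hlt.le]
      exact (hder1 t ⟨ht.1.le, ht.2⟩).congr_of_eventuallyEq hev
    · rw [heq] at ht ⊢
      have hl : HasDerivWithinAt g (g1' y1) (Iic y1) y1 := by
        refine (hder1 y1 ⟨ht.1.le, ht.2⟩).hasDerivWithinAt.congr (fun a ha => hg_le a ha) ?_
        exact hg_le y1 le_rfl
      have hr' : HasDerivWithinAt g (c * g2' y1 / D) (Ici y1) y1 := by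
        have h2 : HasDerivAt (fun a => c * g2 a / D) (c * g2' y1 / D) y1 :=
          ((hder2 y1 ⟨le_rfl, ht.2⟩).const_mul c).div_const D
        exact h2.hasDerivWithinAt.congr (fun a ha => hg_ge a ha) (hg_ge y1 le_rfl)
      rw [← hjunc'] at hr'
      have hu := hl.union hr'
      rw [Iic_union_Ici, hasDerivWithinAt_univ] at hu
      rw [hg'_le y1 le_rfl]
      exact hu
    · have hev : g =ᶠ[𝓝 t] fun a => c * g2 a / D := by
        filter_upwards [Ioi_mem_nhds hgt] with a ha
        exact hg_gt a ha
      have h2 : HasDerivAt (fun a => c * g2 a / D) (c * g2' t / D) t :=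
        ((hder2 t ⟨hgt.le, ht.2⟩).const_mul c).div_const D
      rw [hg'_gt t hgt]
      exact h2.congr_of_eventuallyEq hev
  -- values at 0, signs
  have hg0 : g 0 = 1 := by rw [hg_le 0 hy10]; exact hg10
  have hg'0 : g' 0 = r / (L * Real.log (A / L)) := by
    rw [hg'_le 0 hy10]
    simp only [hg1'def, sub_zero]
    rw [div_self huL0.ne', Real.one_rpow, mul_one]
  have hg'0nn : 0 ≤ g' 0 := by rw [hg'0]; positivity
  have hgpos : ∀ t ∈ Ico 0 L, 0 ≤ g t := by
    intro t ht
    by_cases h : t ≤ y1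
    · rw [hg_le t h]; exact zero_le_one.trans (h1le t ht)
    · rw [hg_gt t (not_le.1 h)]
      exact div_nonneg (mul_nonneg hc0.le (hD0.le.trans (hbnd2 t ⟨(not_le.1 h).le, ht.2⟩).1)) hD0.le
  -- the integrated second-derivative inequality for the glued majorant
  have hρg1 : ∀ t ∈ Ico 0 L, t ≤ y1 →
      ρ t * g t = (1 / ((L - t) ^ 2 * Real.log (A / (L - t)) ^ 2)) * g1 t := by
    intro t ht hty
    rw [hρeq t ht, hg_le t hty]
  have hρg2 : ∀ t ∈ Ico 0 L, y1 ≤ t →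
      ρ t * g t = (c / D) * ((1 / ((L - t) ^ 2 * Real.log (A / (L - t)) ^ 2)) * g2 t) := by
    intro t ht hty
    rw [hρeq t ht, hg_ge t hty]; ring
  have hineq : ∀ t ∈ Ico 0 L, g' 0 + r ^ 2 * ∫ τ in (0 : ℝ)..t, ρ τ * g τ ≤ g' t := by
    intro t ht
    by_cases hty : t ≤ y1
    · have hcongr : ∫ τ in (0 : ℝ)..t, ρ τ * g τ = ∫ τ in (0 : ℝ)..t,
          (1 / ((L - τ) ^ 2 * Real.log (A / (L - τ)) ^ 2)) * g1 τ := by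
        refine intervalIntegral.integral_congr fun τ hτ => ?_
        rw [uIcc_of_le ht.1] at hτ
        exact hρg1 τ ⟨hτ.1, hτ.2.trans_lt ht.2⟩ (hτ.2.trans hty)
      rw [hg'0, hcongr, hg'_le t hty]
      exact hineq1 t ht
    · push Not at hty
      have hi1 : IntervalIntegrable (fun τ => ρ τ * g τ) volume 0 y1 := by
        refine ((hρcont.mul hgc).mono ?_).intervalIntegrable_of_Icc hy10
        exact fun τ hτ => ⟨hτ.1, hτ.2.trans_lt hy1L⟩
      have hi2 : IntervalIntegrable (fun τ => ρ τ * g τ) volume y1 t := by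
        refine ((hρcont.mul hgc).mono ?_).intervalIntegrable_of_Icc hty.le
        exact fun τ hτ => ⟨hy10.trans hτ.1, hτ.2.trans_lt ht.2⟩
      rw [← intervalIntegral.integral_add_adjacent_intervals hi1 hi2]
      have hpart1 : g' 0 + r ^ 2 * ∫ τ in (0 : ℝ)..y1, ρ τ * g τ ≤ g1' y1 := by
        have hcongr : ∫ τ in (0 : ℝ)..y1, ρ τ * g τ = ∫ τ in (0 : ℝ)..y1,
            (1 / ((L - τ) ^ 2 * Real.log (A / (L - τ)) ^ 2)) * g1 τ := by
          refine intervalIntegral.integral_congr fun τ hτ => ?_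
          rw [uIcc_of_le hy10] at hτ
          exact hρg1 τ ⟨hτ.1, hτ.2.trans_lt hy1L⟩ hτ.2
        rw [hg'0, hcongr]
        exact hineq1 y1 ⟨hy10, hy1L⟩
      have hpart2 : g1' y1 + r ^ 2 * ∫ τ in y1..t, ρ τ * g τ ≤ g' t := by
        have hcongr : ∫ τ in y1..t, ρ τ * g τ = (c / D) * ∫ τ in y1..t,
            (1 / ((L - τ) ^ 2 * Real.log (A / (L - τ)) ^ 2)) * g2 τ := by
          rw [← intervalIntegral.integral_const_mul]
          refine intervalIntegral.integral_congr fun τ hτ => ?_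
          rw [uIcc_of_le hty.le] at hτ
          exact hρg2 τ ⟨hy10.trans hτ.1, hτ.2.trans_lt ht.2⟩ hτ.1
        have h2 := hineq2 t ⟨hty.le, ht.2⟩
        have hval : (1 / 2) * u0 ^ (-(3 / 2 : ℝ)) / t1 = g2' y1 := by
          simp only [hg2'def]; rw [huy1', hLy1]
        rw [hval] at h2
        rw [hcongr, hjunc', hg'_gt t hty]
        have hcD : 0 ≤ c / D := (div_pos hc0 hD0).le
        have := mul_le_mul_of_nonneg_left h2 hcD
        have hrw : c * g2' y1 / D + r ^ 2 * (c / D * ∫ τ in y1..t,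
            1 / ((L - τ) ^ 2 * Real.log (A / (L - τ)) ^ 2) * g2 τ) =
            c / D * (g2' y1 + r ^ 2 * ∫ τ in y1..t,
              1 / ((L - τ) ^ 2 * Real.log (A / (L - τ)) ^ 2) * g2 τ) := by ring
        rw [hrw, show c * g2' t / D = c / D * g2' t by ring]
        exact this
      calc g' 0 + r ^ 2 * ((∫ τ in (0 : ℝ)..y1, ρ τ * g τ) + ∫ τ in y1..t, ρ τ * g τ)
          = (g' 0 + r ^ 2 * ∫ τ in (0 : ℝ)..y1, ρ τ * g τ) + r ^ 2 * ∫ τ in y1..t, ρ τ * g τ := by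
            ring
        _ ≤ g1' y1 + r ^ 2 * ∫ τ in y1..t, ρ τ * g τ := add_le_add hpart1 le_rfl
        _ ≤ g' t := hpart2
  -- Taylor: the integral supersolution inequality (Lebesgue form)
  have hT := stub_taylorSuper L (r ^ 2) ρ g g' (sq_nonneg r) hρcont (fun t _ => hρnn t) hgc hg'c
    hder (by rw [hg0]) hg'0nn hgpos hineq
  -- pass to the string's mass measure
  have hyd : y ∈ S.dom := ⟨hy.1, by rw [hlen]; exact (ENNReal.ofReal_lt_ofReal_iff hL).2 hy.2⟩
  have hsuper : ∀ y' ∈ Icc 0 y, 1 + r ^ 2 * ∫ t in Icc 0 y', (y' - t) * g t ∂S.massMeasure ≤ g y' := by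
    intro y' hy'
    have hy'L : y' < L := hy'.2.trans_lt hy.2
    have hsub : Icc 0 y' ⊆ Iio L := fun t ht => ht.2.trans_lt hy'L
    have hconv : ∫ t in Icc 0 y', (y' - t) * g t ∂S.massMeasure =
        ∫ t in Icc 0 y', (y' - t) * g t * ρ t := by
      rw [hmass, Measure.restrict_restrict measurableSet_Icc, inter_eq_left.2 hsub,
        restrict_withDensity measurableSet_Icc,
        integral_withDensity_eq_integral_toReal_smul hρmeas.ennreal_ofReal
          (Eventually.of_forall fun t => ENNReal.ofReal_lt_top)]
      refine integral_congr_ae (Eventually.of_forall fun t => ?_)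
      simp only [smul_eq_mul, ENNReal.toReal_ofReal (hρnn t)]
      ring
    rw [hconv]
    exact hT y' ⟨hy'.1, hy'L⟩
  have hbound := phi_neg_re_le_of_supersolution S (sq_nonneg r) hyd
    (hgc.mono fun t ht => ⟨ht.1, ht.2.trans_lt hy.2⟩) (fun t ht => hgpos t ⟨ht.1, ht.2.trans_lt hy.2⟩)
    hsuper ⟨hy.1, le_rfl⟩
  refine hbound.trans ?_
  -- `g ≤ c K / D = c (1 + 2r)`
  have hcK : c * K / D = c * (1 + 2 * r) := by rw [mul_div_assoc, hKoverD]
  show g y ≤ c * (1 + 2 * r)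
  rw [← hcK]
  by_cases h : y ≤ y1
  · rw [hg_le y h]
    calc g1 y ≤ g1 y1 := hmono1 hy ⟨hy10, hy1L⟩ h
      _ = c := hg1y1
      _ ≤ c * K / D := by rw [hcK]; nlinarith
  · rw [hg_gt y (not_le.1 h)]
    exact div_le_div_of_nonneg_right (mul_le_mul_of_nonneg_left
      (hbnd2 y ⟨(not_le.1 h).le, hy.2⟩).2 hc0.le) hD0.le

end Summit.RiemannHypothesis.RiemannHypothesis.Theorems.LeeYangTelegraphString

end
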